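import Literature.Barriers.Schanuel.NesterenkoModularScopeOperator
import Literature.Barriers.Schanuel.NesterenkoModularScopeSeriesProofs
import Mathlib.Algebra.MvPolynomial.CommRing
import HarnessLib

/-!
# Barrier (Schanuel) `NesterenkoModularScope`: degree bookkeeping for `B_T = ∏_{k<T}(12D − 12k) A` (LNM 1752 Ch. 3, (16)) — proofs only

`Literature/Barriers/Schanuel/NesterenkoModularScopeOperatorProofs.lean` — sibling proofs file of
`NesterenkoModularScopeOperator.lean`. No new definitions; proofs only. The degree half of the
bounds (16) of LNM 1752 Ch. 3 Lemma 3.4 for the polynomials `B_T` (`nesterenkoB A T`):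

* `nesterenkoD12_apply`: the derivation `12D` is
  `12 z ∂/∂z + (x₁² − x₂) ∂/∂x₁ + 4(x₁x₂ − x₃) ∂/∂x₂ + 6(x₁x₃ − x₂²) ∂/∂x₃` (formula (15));
* `degreeOf_zero_nesterenkoB_le`: `deg_z B_T ≤ deg_z A` ("`deg_z B ≤ N`");
* `totalDegree_nesterenkoB_le`: `deg B_T ≤ deg A + T` (each application of `12D − 12k` raises
  the total degree by at most one: quadratic coefficients times a first-order derivative), whence
  `deg_{xᵢ} B_T ≤ deg A + T ≤ 4N + T` for `deg_z A, deg_{xᵢ} A ≤ N` (the printed majorant gives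
  `3N + T`; either is `≤ 2γ N log M` in Lemma 3.4).

## References

* [NesterenkoPhilippon2001] LNM 1752 (2001), Ch. 3 §3 (14)–(15) and Lemma 3.4 (p. 36), (16)–(18)
  (p. 37), (19) and the proof of Lemma 3.4 (p. 38).
-/

noncomputable section

open MvPolynomial
open Literature.NumberTheory.Transcendental

namespace Literature.Barriers.Schanuel

/-! ### Supports and degrees of partial derivatives -/

/-- A monomial of `∂p/∂xᵢ` comes from a monomial of `p` with one more `xᵢ`. [folklore] -/
theorem add_single_mem_support_of_mem_support_pderiv {σ R : Type*} [CommSemiring R] {i : σ}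
    {p : MvPolynomial σ R} {m : σ →₀ ℕ} (hm : m ∈ (pderiv i p).support) :
    m + Finsupp.single i 1 ∈ p.support := by
  rw [mem_support_iff] at hm ⊢
  rw [coeff_pderiv] at hm
  exact left_ne_zero_of_mul hm

/-- `deg (f · ∂p/∂xᵢ) ≤ deg f + deg p − 1`. [folklore] -/
theorem totalDegree_mul_pderiv_le {σ R : Type*} [CommSemiring R] (i : σ) (f p : MvPolynomial σ R) :
    (f * pderiv i p).totalDegree ≤ f.totalDegree + p.totalDegree - 1 := by
  classical
  rw [totalDegree]
  refine Finset.sup_le fun s hs => ?_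
  obtain ⟨a, ha, m, hm, rfl⟩ := Finset.mem_add.mp (support_mul f (pderiv i p) hs)
  have h1 : (a.sum fun _ e => e) ≤ f.totalDegree := le_totalDegree ha
  have h2 : ((m + Finsupp.single i 1).sum fun _ e => e) ≤ p.totalDegree :=
    le_totalDegree (add_single_mem_support_of_mem_support_pderiv hm)
  rw [Finsupp.sum_add_index' (fun _ => rfl) (fun _ _ _ => rfl), Finsupp.sum_single_index rfl] at h2
  rw [Finsupp.sum_add_index' (fun _ => rfl) (fun _ _ _ => rfl)]
  omega

/-- `deg_{xⱼ} ∂p/∂xᵢ ≤ deg_{xⱼ} p`. [folklore] -/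
theorem degreeOf_pderiv_le {σ R : Type*} [CommSemiring R] (i j : σ) (p : MvPolynomial σ R) :
    (pderiv i p).degreeOf j ≤ p.degreeOf j := by
  classical
  rw [degreeOf_le_iff]
  intro m hm
  have h : (m + Finsupp.single i 1 : σ →₀ ℕ) j ≤ p.degreeOf j :=
    (degreeOf_le_iff.mp (le_refl (p.degreeOf j))) _
      (add_single_mem_support_of_mem_support_pderiv hm)
  have : m j ≤ (m + Finsupp.single i 1 : σ →₀ ℕ) j := by
    rw [Finsupp.add_apply]; exact Nat.le_add_right _ _
  exact this.trans h

/-- `deg_{xᵢ} (xᵢ ∂p/∂xᵢ) ≤ deg_{xᵢ} p` (Euler operator). [folklore] -/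
theorem degreeOf_X_mul_pderiv_le {σ R : Type*} [CommSemiring R] (i : σ) (p : MvPolynomial σ R) :
    (X i * pderiv i p).degreeOf i ≤ p.degreeOf i := by
  classical
  rw [degreeOf_le_iff]
  intro s hs
  rw [support_X_mul, Finset.mem_map] at hs
  obtain ⟨m, hm, rfl⟩ := hs
  have h : (m + Finsupp.single i 1 : σ →₀ ℕ) i ≤ p.degreeOf i :=
    (degreeOf_le_iff.mp (le_refl (p.degreeOf i))) _
      (add_single_mem_support_of_mem_support_pderiv hm)
  rw [addLeftEmbedding_apply, add_comm]
  exact h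

/-! ### The explicit formula (15) for `12D` and its degree bounds -/

/-- Formula (15): `12D E = 12 z ∂E/∂z + (x₁² − x₂) ∂E/∂x₁ + 4(x₁x₂ − x₃) ∂E/∂x₂ + 6(x₁x₃ − x₂²) ∂E/∂x₃`.
[cite: NesterenkoPhilippon2001, Ch. 3 §3 (15) (p. 36)] -/
theorem nesterenkoD12_apply (E : MvPolynomial (Fin 4) ℤ) :
    nesterenkoD12 E = C 12 * (X 0 * pderiv 0 E) + (X 1 ^ 2 - X 2) * pderiv 1 E +
      C 4 * ((X 1 * X 2 - X 3) * pderiv 2 E) + C 6 * ((X 1 * X 3 - X 2 ^ 2) * pderiv 3 E) := by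
  set D' : Derivation ℤ (MvPolynomial (Fin 4) ℤ) (MvPolynomial (Fin 4) ℤ) :=
    (C 12 * X 0 : MvPolynomial (Fin 4) ℤ) • pderiv 0 +
      (X 1 ^ 2 - X 2 : MvPolynomial (Fin 4) ℤ) • pderiv 1 +
      (C 4 * (X 1 * X 2 - X 3) : MvPolynomial (Fin 4) ℤ) • pderiv 2 +
      (C 6 * (X 1 * X 3 - X 2 ^ 2) : MvPolynomial (Fin 4) ℤ) • pderiv 3 with hD'
  have hD : nesterenkoD12 = D' := by
    refine MvPolynomial.derivation_ext fun j => ?_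
    rw [nesterenkoD12_X]
    fin_cases j <;>
      simp [hD', Derivation.add_apply, Derivation.smul_apply, pderiv_X, map_ofNat]
  rw [hD, hD']
  simp only [Derivation.add_apply, Derivation.smul_apply, smul_eq_mul]
  ring

/-- `deg_z (12D E) ≤ deg_z E`. [cite: NesterenkoPhilippon2001, Ch. 3 §3 (16) (p. 37)] -/
theorem degreeOf_zero_nesterenkoD12_le (E : MvPolynomial (Fin 4) ℤ) :
    (nesterenkoD12 E).degreeOf 0 ≤ E.degreeOf 0 := by
  classical
  rw [nesterenkoD12_apply]
  have hX : ∀ j : Fin 4, j ≠ 0 → (X j : MvPolynomial (Fin 4) ℤ).degreeOf 0 = 0 := by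
    intro j hj
    rw [degreeOf_X, if_neg (Ne.symm hj)]
  have h1 : (X 1 ^ 2 - X 2 : MvPolynomial (Fin 4) ℤ).degreeOf 0 = 0 := by
    apply Nat.le_zero.mp
    refine (degreeOf_sub_le _ _ _).trans (max_le ((degreeOf_pow_le _ _ _).trans ?_) ?_)
    · rw [hX 1 (by decide)]
    · rw [hX 2 (by decide)]
  have h2 : (X 1 * X 2 - X 3 : MvPolynomial (Fin 4) ℤ).degreeOf 0 = 0 := by
    apply Nat.le_zero.mp
    refine (degreeOf_sub_le _ _ _).trans (max_le ((degreeOf_mul_le _ _ _).trans ?_) ?_)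
    · rw [hX 1 (by decide), hX 2 (by decide)]
    · rw [hX 3 (by decide)]
  have h3 : (X 1 * X 3 - X 2 ^ 2 : MvPolynomial (Fin 4) ℤ).degreeOf 0 = 0 := by
    apply Nat.le_zero.mp
    refine (degreeOf_sub_le _ _ _).trans (max_le ((degreeOf_mul_le _ _ _).trans ?_)
      ((degreeOf_pow_le _ _ _).trans ?_))
    · rw [hX 1 (by decide), hX 3 (by decide)]
    · rw [hX 2 (by decide)]
  have t0 : (C 12 * (X 0 * pderiv 0 E) : MvPolynomial (Fin 4) ℤ).degreeOf 0 ≤ E.degreeOf 0 :=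
    (degreeOf_C_mul_le _ _ _).trans (degreeOf_X_mul_pderiv_le 0 E)
  have t1 : ((X 1 ^ 2 - X 2) * pderiv 1 E : MvPolynomial (Fin 4) ℤ).degreeOf 0 ≤ E.degreeOf 0 := by
    refine (degreeOf_mul_le _ _ _).trans ?_
    rw [h1, zero_add]; exact degreeOf_pderiv_le 1 0 E
  have t2 : (C 4 * ((X 1 * X 2 - X 3) * pderiv 2 E) : MvPolynomial (Fin 4) ℤ).degreeOf 0 ≤
      E.degreeOf 0 := by
    refine (degreeOf_C_mul_le _ _ _).trans ((degreeOf_mul_le _ _ _).trans ?_)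
    rw [h2, zero_add]; exact degreeOf_pderiv_le 2 0 E
  have t3 : (C 6 * ((X 1 * X 3 - X 2 ^ 2) * pderiv 3 E) : MvPolynomial (Fin 4) ℤ).degreeOf 0 ≤
      E.degreeOf 0 := by
    refine (degreeOf_C_mul_le _ _ _).trans ((degreeOf_mul_le _ _ _).trans ?_)
    rw [h3, zero_add]; exact degreeOf_pderiv_le 3 0 E
  refine (degreeOf_add_le _ _ _).trans (max_le ((degreeOf_add_le _ _ _).trans
    (max_le ((degreeOf_add_le _ _ _).trans (max_le t0 t1)) t2)) t3)

/-- `deg (12D E) ≤ deg E + 1`. [cite: NesterenkoPhilippon2001, Ch. 3 §3 proof of Lemma 3.4 (p. 38)] -/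
theorem totalDegree_nesterenkoD12_le (E : MvPolynomial (Fin 4) ℤ) :
    (nesterenkoD12 E).totalDegree ≤ E.totalDegree + 1 := by
  rw [nesterenkoD12_apply]
  have hC : ∀ (a : ℤ) (p : MvPolynomial (Fin 4) ℤ), (C a * p).totalDegree ≤ p.totalDegree :=
    fun a p => (totalDegree_mul _ _).trans (by rw [totalDegree_C, zero_add])
  have hX : ∀ j : Fin 4, (X j : MvPolynomial (Fin 4) ℤ).totalDegree = 1 := fun j => totalDegree_X j
  have q1 : (X 1 ^ 2 - X 2 : MvPolynomial (Fin 4) ℤ).totalDegree ≤ 2 :=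
    (totalDegree_sub _ _).trans (max_le (by rw [totalDegree_X_pow]) (by rw [hX]; norm_num))
  have q2 : (X 1 * X 2 - X 3 : MvPolynomial (Fin 4) ℤ).totalDegree ≤ 2 :=
    (totalDegree_sub _ _).trans (max_le ((totalDegree_mul _ _).trans (by rw [hX, hX]))
      (by rw [hX]; norm_num))
  have q3 : (X 1 * X 3 - X 2 ^ 2 : MvPolynomial (Fin 4) ℤ).totalDegree ≤ 2 :=
    (totalDegree_sub _ _).trans (max_le ((totalDegree_mul _ _).trans (by rw [hX, hX]))
      (by rw [totalDegree_X_pow]))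
  have t0 : (C 12 * (X 0 * pderiv 0 E) : MvPolynomial (Fin 4) ℤ).totalDegree ≤ E.totalDegree + 1 := by
    refine (hC _ _).trans ((totalDegree_mul_pderiv_le 0 _ E).trans ?_)
    rw [hX]; omega
  have t1 : ((X 1 ^ 2 - X 2) * pderiv 1 E : MvPolynomial (Fin 4) ℤ).totalDegree ≤ E.totalDegree + 1 :=
    (totalDegree_mul_pderiv_le 1 _ E).trans (by omega)
  have t2 : (C 4 * ((X 1 * X 2 - X 3) * pderiv 2 E) : MvPolynomial (Fin 4) ℤ).totalDegree ≤
      E.totalDegree + 1 :=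
    (hC _ _).trans ((totalDegree_mul_pderiv_le 2 _ E).trans (by omega))
  have t3 : (C 6 * ((X 1 * X 3 - X 2 ^ 2) * pderiv 3 E) : MvPolynomial (Fin 4) ℤ).totalDegree ≤
      E.totalDegree + 1 :=
    (hC _ _).trans ((totalDegree_mul_pderiv_le 3 _ E).trans (by omega))
  refine (totalDegree_add _ _).trans (max_le ((totalDegree_add _ _).trans
    (max_le ((totalDegree_add _ _).trans (max_le t0 t1)) t2)) t3)

/-! ### (16) for `B_T` -/

/-- **(16), `z`-degree**: `deg_z B_T ≤ deg_z A`. [cite: NesterenkoPhilippon2001, Ch. 3 Lemma 3.4 (16) (p. 37)] -/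
theorem degreeOf_zero_nesterenkoB_le (A : MvPolynomial (Fin 4) ℤ) :
    ∀ T : ℕ, (nesterenkoB A T).degreeOf 0 ≤ A.degreeOf 0
  | 0 => le_rfl
  | T + 1 => by
    rw [nesterenkoB_succ, ← C_mul']
    refine (degreeOf_sub_le _ _ _).trans (max_le ?_ ?_)
    · exact (degreeOf_zero_nesterenkoD12_le _).trans (degreeOf_zero_nesterenkoB_le A T)
    · exact (degreeOf_C_mul_le _ _ _).trans (degreeOf_zero_nesterenkoB_le A T)

/-- **(16), total degree**: `deg B_T ≤ deg A + T`. [cite: NesterenkoPhilippon2001, Ch. 3 Lemma 3.4 (16) (p. 37)] -/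
theorem totalDegree_nesterenkoB_le (A : MvPolynomial (Fin 4) ℤ) :
    ∀ T : ℕ, (nesterenkoB A T).totalDegree ≤ A.totalDegree + T
  | 0 => by simp
  | T + 1 => by
    rw [nesterenkoB_succ, ← C_mul']
    refine (totalDegree_sub _ _).trans (max_le ?_ ?_)
    · have := totalDegree_nesterenkoD12_le (nesterenkoB A T)
      have := totalDegree_nesterenkoB_le A T
      omega
    · refine (totalDegree_mul _ _).trans ?_
      rw [totalDegree_C, zero_add]
      exact (totalDegree_nesterenkoB_le A T).trans (Nat.le_succ _)

/-- **(16), partial `x`-degrees**: if `deg_z A, deg_{xᵢ} A ≤ N` then `deg_{xᵢ} B_T ≤ 4N + T`.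
[cite: NesterenkoPhilippon2001, Ch. 3 Lemma 3.4 (16) (p. 37)] -/
theorem degreeOf_nesterenkoB_le {A : MvPolynomial (Fin 4) ℤ} {N : ℕ} (hA : ∀ i, A.degreeOf i ≤ N)
    (T : ℕ) (i : Fin 4) : (nesterenkoB A T).degreeOf i ≤ 4 * N + T := by
  refine (degreeOf_le_totalDegree _ _).trans ((totalDegree_nesterenkoB_le A T).trans ?_)
  have h := totalDegree_le_sum_degreeOf A
  rw [Fin.sum_univ_four] at h
  have := hA 0; have := hA 1; have := hA 2; have := hA 3
  omega

end Literature.Barriers.Schanuel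

end
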